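import Summits.BirchSwinnertonDyer.BirchSwinnertonDyer.Theorems.ResidualThetaTransportAtTwoResidualThetaMainConjectureAtTwoPollackLayerK
import Summits.BirchSwinnertonDyer.BirchSwinnertonDyer.Theorems.ResidualThetaTransportAtTwoResidualThetaMainConjectureAtTwoEulerLayerK
import Summits.BirchSwinnertonDyer.BirchSwinnertonDyer.Theorems.ResidualThetaTransportAtTwoResidualThetaMainConjectureAtTwoAnalyticLayerLawAtTwo
import Summits.BirchSwinnertonDyer.BirchSwinnertonDyer.Theorems.ResidualThetaTransportAtTwoThetaLayerLambdaCongruenceAtTwoLayerModulus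
import Literature.NumberTheory.EllipticCurves.MazurTateElementCoeffField
import Literature.NumberTheory.EllipticCurves.SharpFlatPAdicLFunctionCoeffField
import HarnessLib

/-!
# Crux `ResidualThetaMainConjectureAtTwo` (stmt-BirchSwinnertonDyer-20787), line `birth` v4 — stub (R1b)
# `stub_analyticLayerLawKAtTwo`: the g-side ANALYTIC LAYER LAW over `𝓞` at `2`

Cell `bsd-wall`, seat `bsd-wall-rtt-p2` (LEAD PROVER, line mode, g2). THEOREMS ONLY (no `def`, no named fact, no
`sorry`). This file proves the registered stub (R1b) of skeleton v4 of the crux (route `ResidualThetaTransportAtTwo`,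
rank 2), VERBATIM:

> for a newform `g ∈ S₂(Γ₀(M))`, an embedding `ι : K_g → ℚ̄₂`, any `Ω`, every Pollack pair `(L⁺, L⁻) ∈ 𝓞⟦T⟧²`
> (`𝓞 = 𝓞_{ℚ₂(ι K_g)}`, `IsPollackPairK g ι Ω L⁺ L⁻`) whose `L⁻` has Gauss norm first attained at the index `d`
> (the norm-language λ-invariant of `L⁻`), and every finite set `S₀` of odd places: for all large EVEN `n`,
> `λ_n(θ^{S₀}_n(g; Ω) via ι) = d + Σ_{v∈S₀} 2^{n_ℓ}·d_{g,ℓ} + (2ⁿ − 1)/3`,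
> where `λ_n` is Pollack–Weston's layer `λ` (`layerLambda`) of the `S₀`-depleted Mazur–Tate element of `g` through `ι`
> reduced modulo `ω_n = (X+1)^{2ⁿ} − 1`, and `d_{g,ℓ} = (ℓ ∣ M ? (‖ι a_ℓ − 1‖ < 1 ? 1 : 0) : (‖ι a_ℓ‖ < 1 ? 2 : 0))`.

PROOF (R2's method in norm language; the partner's CM structure is inert here). For even `n` the Pollack congruence
`2^m(θ_n(g)^ι − (−1)^{n/2+1} ω_n^- L⁻) = ω_n q` (`IsPollackPairK`, Pollack Prop. 6.18) with `ω_n ≡ X^{2ⁿ}`,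
`ω_n^- ≡ X^{(2ⁿ−1)/3}` modulo coefficients of norm `≤ 2⁻¹` (`map_cyclotomicOmegaMinus_zmod`, `sum_two_pow_layer`)
gives, by the norm-language layer law `supNorm_eq_and_layerLambda_eq_of_layerCongruence` (file `…PollackLayerK`),
`λ(θ_n(g)^ι) = (2ⁿ−1)/3 + d` once `(2ⁿ−1)/3 + d < 2ⁿ`; the layer Euler factors of `g` have `λ = 2^{n_ℓ} d_{g,ℓ}`
(file `…EulerLayerK`, needs `ι a_ℓ` integral: Shimura 3.48); `λ` is additive and survives reduction modulo `ω_n` below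
degree `2ⁿ` (rtt-p3's `layerLambda_mul`, `layerLambda_mul_modByMonic_layerModulus`). BSD is not proved by any of
this; the crux's research stub (R1a) and the existence stub (R1c) are open.

References: R. Pollack, Duke Math. J. 118 (2003) Prop. 6.18 [Pollack2003]; R. Pollack, T. Weston, Duke Math. J. 156
(2011) §3.1, §4 [PollackWeston2011MT]; R. Greenberg, V. Vatsal, Invent. Math. 142 (2000) Prop. (2.4), (9)–(10)
[GreenbergVatsal2000].
-/

set_option linter.dupNamespace false
set_option autoImplicit false

noncomputable section

open scoped Classical

open Polynomial NumberField IsDedekindDomain Literature.NumberTheory.EllipticCurves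
  Literature.NumberTheory.EllipticCurves.ModularForms Literature.NumberTheory.EllipticCurves.GreenbergVatsal2000
  Literature.NumberTheory.IwasawaTheory Rat.HeightOneSpectrum
  Summit.BirchSwinnertonDyer.Rank1Residual.X2.EulerFactorInvariants
  Summit.BirchSwinnertonDyer.BirchSwinnertonDyer.Theorems.ThetaLayerLambdaCongruenceAtTwo

namespace Summit.BirchSwinnertonDyer.BirchSwinnertonDyer.Theorems.ResidualThetaLayer

/-! ## §1. Small facts: `deg θ_n(g) < pⁿ`, `λ` of a product, the two moduli in norm language -/

section Facts

/-- The Mazur–Tate element `θ_n(g; Ω) ∈ K_g[X]` has no coefficients in degrees `≥ pⁿ` (it is a combination of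
`(X+1)^s`, `s < pⁿ`). [cite: PollackWeston2011MT, §2.1 (2.1)] -/
theorem coeff_mazurTateElementK_eq_zero {N : ℕ} (g : CuspForm (CongruenceSubgroup.Gamma0 N) 2) (Ω : ℂ) (p : ℕ)
    [Fact p.Prime] (n : ℕ) {j : ℕ} (hj : p ^ n ≤ j) : (mazurTateElementK g Ω p n).coeff j = 0 := by
  classical
  haveI := neZero_torsionOrder p
  haveI := Fintype.ofFinite (rootsOfUnity (torsionOrder p) ℤ_[p])
  rw [coeff_mazurTateElementK]
  refine Finset.sum_eq_zero fun ξ _ ↦ Finset.sum_eq_zero fun s _ ↦ ?_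
  rw [Nat.choose_eq_zero_of_lt (lt_of_lt_of_le (ZMod.val_lt s) hj), Nat.cast_zero, mul_zero]

variable {K : Type*} [NormedField K] [IsUltrametricDist K]

/-- `λ` of a finite product of non-zero polynomials over an ultrametric normed field is the sum of the `λ`'s, and
the product is non-zero (Gauss's lemma with `λ`, iterated). [cite: PollackWeston2011MT, §3.1] -/
theorem prod_ne_zero_and_layerLambda_prod {ι' : Type*} (s : Finset ι') (F : ι' → K[X]) (h : ∀ i ∈ s, F i ≠ 0) :
    (∏ i ∈ s, F i) ≠ 0 ∧ layerLambda (∏ i ∈ s, F i) = ∑ i ∈ s, layerLambda (F i) := by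
  classical
  induction s using Finset.induction_on with
  | empty =>
    refine ⟨by simp, ?_⟩
    rw [Finset.prod_empty, Finset.sum_empty, layerLambda_eq_iff]
    refine ⟨by rw [← C_1, supNorm_C, coeff_C_zero], fun j hj ↦ absurd hj (Nat.not_lt_zero j)⟩
  | insert a s ha ih =>
    have hF : F a ≠ 0 := h a (Finset.mem_insert_self a s)
    obtain ⟨hne, hlam⟩ := ih fun i hi ↦ h i (Finset.mem_insert_of_mem hi)
    rw [Finset.prod_insert ha, Finset.sum_insert ha]
    exact ⟨mul_ne_zero hF hne, by rw [layerLambda_mul hF hne, hlam]⟩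

/-- The layer modulus read from `ℤ[X]`: `(cyclotomicOmega p n).map ℤ→ℚ̄_p = (X+1)^{pⁿ} − 1` has leading coefficient
`1` in degree `pⁿ` and all other coefficients of norm `≤ p⁻¹`. [folklore] -/
theorem coeff_map_cyclotomicOmega_norm (p : ℕ) [Fact p.Prime] (n : ℕ) :
    ((cyclotomicOmega p n).map (Int.castRingHom (PadicAlgCl p))).coeff (p ^ n) = 1 ∧
      ∀ j, j ≠ p ^ n → ‖((cyclotomicOmega p n).map (Int.castRingHom (PadicAlgCl p))).coeff j‖ ≤ (p : ℝ)⁻¹ := by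
  have hmap : (cyclotomicOmega p n).map (Int.castRingHom (PadicAlgCl p)) = (X + 1) ^ p ^ n - 1 := by
    rw [cyclotomicOmega, Polynomial.map_sub, Polynomial.map_pow, Polynomial.map_add, Polynomial.map_X,
      Polynomial.map_one]
  rw [hmap]
  have hpn : p ^ n ≠ 0 := (pow_pos (Fact.out : p.Prime).pos n).ne'
  refine ⟨?_, fun j hj ↦ ?_⟩
  · rw [coeff_sub, coeff_X_add_one_pow, Nat.choose_self, Nat.cast_one, coeff_one, if_neg hpn, sub_zero]
  · have h1 : ((X + 1) ^ p ^ n - 1 : (PadicAlgCl p)[X]).coeff j =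
        ((X + 1) ^ p ^ n - 1 - X ^ p ^ n : (PadicAlgCl p)[X]).coeff j := by
      rw [coeff_sub _ (X ^ p ^ n), coeff_X_pow, if_neg hj, sub_zero]
    rw [h1]
    exact (le_supNorm _ j).trans (supNorm_layerModulus_sub_X_pow_le n)

/-- The signed half-modulus read from `ℤ[X]` at `p = 2`, even `n`: `((−1)^{n/2+1} ω_n^-).map ℤ→ℚ̄₂` has a coefficient
of norm `1` in degree `(2ⁿ − 1)/3` and all other coefficients of norm `≤ 2⁻¹` (`ω_n^- ≡ X^{(2ⁿ−1)/3} (mod 2)`).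
[cite: Pollack2003, §6.5 (display before Prop. 6.18)] -/
theorem coeff_map_signedOmegaMinus_norm_two {n : ℕ} (hn : Even n) :
    ‖(((-1) ^ (n / 2 + 1) * cyclotomicOmegaMinus 2 n).map (Int.castRingHom (PadicAlgCl 2))).coeff
        ((2 ^ n - 1) / 3)‖ = 1 ∧
      ∀ j, j ≠ (2 ^ n - 1) / 3 →
        ‖(((-1) ^ (n / 2 + 1) * cyclotomicOmegaMinus 2 n).map (Int.castRingHom (PadicAlgCl 2))).coeff j‖ ≤
          (2 : ℝ)⁻¹ := by
  obtain ⟨j₀, hj₀⟩ := hn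
  set ωZ : ℤ[X] := (-1) ^ (n / 2 + 1) * cyclotomicOmegaMinus 2 n with hωZ
  set D : ℕ := (2 ^ n - 1) / 3 with hD
  -- reduction mod 2: `ωZ ≡ u · X^D`
  have hbar : ωZ.map (Int.castRingHom (ZMod 2)) = C ((-1 : ZMod 2) ^ (n / 2 + 1)) * X ^ D := by
    rw [hωZ, Polynomial.map_mul, Polynomial.map_pow, Polynomial.map_neg, Polynomial.map_one,
      map_cyclotomicOmegaMinus_zmod, show (n + 1) / 2 = j₀ by omega, sum_two_pow_layer, show 2 * j₀ = n by omega,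
      ← hD, map_pow, map_neg, C_1]
  have hcoeffbar : ∀ j, (Int.castRingHom (ZMod 2)) (ωZ.coeff j) =
      if j = D then ((-1 : ZMod 2) ^ (n / 2 + 1)) else 0 := by
    intro j
    rw [← Polynomial.coeff_map, hbar, coeff_C_mul_X_pow]
  -- transfer integer coefficients to `ℚ̄₂`
  set φ : ℤ_[2] →+* PadicAlgCl 2 := (algebraMap ℚ_[2] (PadicAlgCl 2)).comp (algebraMap ℤ_[2] ℚ_[2]) with hφ
  have hnormK : ∀ z : ℤ, ‖((z : ℤ) : PadicAlgCl 2)‖ = ‖(z : ℤ_[2])‖ := fun z ↦ by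
    rw [← map_intCast φ z, norm_algebraMap_padicInt_padicAlgCl]
  have hcoeffK : ∀ j, (ωZ.map (Int.castRingHom (PadicAlgCl 2))).coeff j = ((ωZ.coeff j : ℤ) : PadicAlgCl 2) := by
    intro j; rw [Polynomial.coeff_map, eq_intCast]
  refine ⟨?_, fun j hj ↦ ?_⟩
  · rw [hcoeffK, hnormK]
    have h1 : ¬ (2 : ℤ) ∣ ωZ.coeff D := by
      intro h2
      have h3 := hcoeffbar D
      rw [if_pos rfl, eq_intCast, (ZMod.intCast_zmod_eq_zero_iff_dvd _ 2).mpr (by exact_mod_cast h2)] at h3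
      exact pow_ne_zero _ (neg_ne_zero.mpr one_ne_zero) h3.symm
    have h4 : ¬ ‖(ωZ.coeff D : ℤ_[2])‖ < 1 := fun h ↦ h1 (by exact_mod_cast (PadicInt.norm_int_lt_one_iff_dvd _).mp h)
    exact le_antisymm (PadicInt.norm_le_one _) (not_lt.mp h4)
  · rw [hcoeffK, hnormK]
    have h2 : (2 : ℤ) ∣ ωZ.coeff j := by
      have h3 := hcoeffbar j
      rw [if_neg hj, eq_intCast, ZMod.intCast_zmod_eq_zero_iff_dvd] at h3
      exact_mod_cast h3
    obtain ⟨w, hw⟩ := h2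
    rw [hw, Int.cast_mul, norm_mul, Int.cast_ofNat]
    calc ‖(2 : ℤ_[2])‖ * ‖(w : ℤ_[2])‖ ≤ (2 : ℝ)⁻¹ * 1 := by
          refine mul_le_mul ?_ (PadicInt.norm_le_one _) (norm_nonneg _) (by norm_num)
          have := PadicInt.norm_p (p := 2)
          rw [show ((2 : ℕ) : ℤ_[2]) = 2 from rfl] at this
          exact this.le
      _ = (2 : ℝ)⁻¹ := mul_one _

end Facts

/-! ## §2. Stub (R1b): the g-side analytic layer law over `𝓞` at `2` -/

section Stub

/-- **Stub (R1b) `stub_analyticLayerLawKAtTwo` of crux `ResidualThetaMainConjectureAtTwo` (line `birth` v4): the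
g-side analytic layer law over `𝓞` at `2`** — for all large even `n`,
`λ_n(θ^{S₀}_n(g; Ω) via ι) = d + Σ_{v∈S₀} 2^{n_ℓ} d_{g,ℓ} + (2ⁿ − 1)/3` (statement VERBATIM the registered stub; see the
module docstring for the proof). [cite: Pollack2003, Prop. 6.18] [cite: PollackWeston2011MT, §3.1 and §4]
[cite: GreenbergVatsal2000, §2 Prop. (2.4) and §1 (9)] -/
theorem stub_analyticLayerLawKAtTwo : ∀ (M : ℕ) [NeZero M] (g : CuspForm (CongruenceSubgroup.Gamma0 M) 2) (ι : Literature.NumberTheory.EllipticCurves.ModularForms.coeffField g →+* PadicAlgCl 2) (Ω : ℂ), Literature.NumberTheory.EllipticCurves.ModularForms.IsNewform0 g → ∀ (Lp Lm : Literature.NumberTheory.EllipticCurves.IwasawaAlgebraO (Set.range ι)) (d : ℕ), Literature.NumberTheory.EllipticCurves.IsPollackPairK g ι Ω Lp Lm → (∀ k : ℕ, ‖PowerSeries.coeff k (Literature.NumberTheory.EllipticCurves.iwasawaOToPowerSeries (Set.range ι) Lm)‖ ≤ ‖PowerSeries.coeff d (Literature.NumberTheory.EllipticCurves.iwasawaOToPowerSeries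 (Set.range ι) Lm)‖) → (∀ k : ℕ, k < d → ‖PowerSeries.coeff k (Literature.NumberTheory.EllipticCurves.iwasawaOToPowerSeries (Set.range ι) Lm)‖ < ‖PowerSeries.coeff d (Literature.NumberTheory.EllipticCurves.iwasawaOToPowerSeries (Set.range ι) Lm)‖) → ∀ (S₀ : Finset (IsDedekindDomain.HeightOneSpectrum (NumberField.RingOfIntegers ℚ))), (∀ v ∈ S₀, ((2 : ℕ) : NumberField.RingOfIntegers ℚ) ∉ v.asIdeal) → ∃ n₀ : ℕ, ∀ n ≥ n₀, Even n → Literature.NumberTheory.IwasawaTheory.layerLambda (((Literature.NumberTheory.EllipticCurves.mazurTateElementK g Ω 2 n).map ι * ∏ v ∈ S₀, (1 - Polynomial.C (Literature.NumberTheory.EllipticCurves.embCoeff g ι (Rat.HeightOneSpectrum.natGenerator v)) * Polynomial.X + (if Rat.HeightOneSpectrum.natGenerator v ∣ M then 0 else Polynomial.C (Rat.HeightOneSpectrum.natGenerator v : PadicAlgCl 2)) * Polynomial.X ^ 2).comp (Polynomial.C ((Rat.HeightOneSpectrum.natGenerator v : PadicAlgCl 2)⁻¹) * (Polynomial.X +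 1) ^ (PadicInt.toZModPow n (-(Literature.NumberTheory.EllipticCurves.GreenbergVatsal2000.frobeniusExponent 2 (Rat.HeightOneSpectrum.natGenerator v : ℤ_[2])))).val)) %ₘ ((Polynomial.X + 1) ^ 2 ^ n - 1)) = d + (∑ v ∈ S₀, 2 ^ padicValNat 2 ((Rat.HeightOneSpectrum.natGenerator v ^ 2 - 1) / 8) * (if Rat.HeightOneSpectrum.natGenerator v ∣ M then (if ‖Literature.NumberTheory.EllipticCurves.embCoeff g ι (Rat.HeightOneSpectrum.natGenerator v) - 1‖ < 1 then 1 else 0) else (if ‖Literature.NumberTheory.EllipticCurves.embCoeff g ι (Rat.HeightOneSpectrum.natGenerator v)‖ < 1 then 2 else 0))) + (2 ^ n - 1) / 3 := by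
  intro M _ g ι Ω hnew Lp Lm d hPK hd1 hd2 S₀ hS2
  -- the norm-λ datum of `L⁻`: Gauss norm `s > 0` first attained at `d`
  set L : PowerSeries (PadicAlgCl 2) := iwasawaOToPowerSeries (Set.range ι) Lm with hLdef
  set s : ℝ := ‖PowerSeries.coeff d L‖ with hsdef
  have hLm : Lm ≠ 0 := hPK.2.1
  have hs : 0 < s := by
    obtain ⟨k, hk⟩ : ∃ k, PowerSeries.coeff k L ≠ 0 := by
      by_contra h
      push Not at h
      apply hLm
      apply iwasawaOToPowerSeries_injective (Set.range ι)
      rw [map_zero]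
      exact PowerSeries.ext fun k ↦ by rw [← hLdef, h k, map_zero]
    exact (norm_pos_iff.mpr hk).trans_le (hd1 k)
  -- odd places, thresholds
  have hS' : ∀ v ∈ S₀, natGenerator v ≠ 2 := fun v hv ↦ natGenerator_ne_of_natCast_not_mem v (hS2 v hv)
  set t : HeightOneSpectrum (𝓞 ℚ) → ℕ := fun v ↦ padicValNat 2 ((natGenerator v ^ 2 - 1) / 8) with ht
  set dg : HeightOneSpectrum (𝓞 ℚ) → ℕ := fun v ↦
    (if natGenerator v ∣ M then (if ‖embCoeff g ι (natGenerator v) - 1‖ < 1 then 1 else 0)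
      else (if ‖embCoeff g ι (natGenerator v)‖ < 1 then 2 else 0)) with hdg
  set SK : ℕ := ∑ v ∈ S₀, 2 ^ t v * dg v with hSK
  refine ⟨(∑ v ∈ S₀, (t v + 1)) + (2 * (d + SK) + 2), fun n hn heven ↦ ?_⟩
  have htn : ∀ v ∈ S₀, t v < n := fun v hv ↦ by
    have := Finset.single_le_sum (f := fun w ↦ t w + 1) (fun _ _ ↦ Nat.zero_le _) hv
    omega
  have hroom : (2 ^ n - 1) / 3 + (d + SK) < 2 ^ n := layer_room (by omega)
  set D : ℕ := (2 ^ n - 1) / 3 with hD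
  -- (1) the Mazur–Tate side in norm language
  obtain ⟨m, q, hmq⟩ := hPK.2.2.2 n heven
  set θ : (PadicAlgCl 2)[X] := (mazurTateElementK g Ω 2 n).map ι with hθdef
  obtain ⟨hωN, hω⟩ := coeff_map_cyclotomicOmega_norm 2 n
  obtain ⟨hωmD, hωm⟩ := coeff_map_signedOmegaMinus_norm_two heven
  have hc : (((2 : ℕ) : PadicAlgCl 2) ^ m) ≠ 0 := pow_ne_zero _ (by norm_num)
  have hθcoeff : ∀ j, 2 ^ n ≤ j → θ.coeff j = 0 := fun j hj ↦ by
    rw [hθdef, coeff_map, coeff_mazurTateElementK_eq_zero g Ω 2 n hj, map_zero]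
  have hq : ∃ B : ℝ, ∀ k, ‖PowerSeries.coeff k (iwasawaOToPowerSeries (Set.range ι) q)‖ ≤ B :=
    ⟨1, norm_coeff_iwasawaOToPowerSeries_le_one (Set.range ι) q⟩
  have hhalf : (2 : ℝ)⁻¹ < 1 := by norm_num
  have hp2 : ((2 : ℕ) : ℝ)⁻¹ = (2 : ℝ)⁻¹ := by norm_num
  obtain ⟨hθsup, hθlam⟩ := supNorm_eq_and_layerLambda_eq_of_layerCongruence (N := 2 ^ n) (D := D) (d := d)
    (r := (2 : ℝ)⁻¹) (s := s) hhalf hs hc hθcoeff hωN (fun j hj ↦ hp2 ▸ hω j hj) hωmD hωm hd1 rfl hd2 hq hmq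
    (by omega)
  have hθne : θ ≠ 0 := fun h ↦ by rw [h, supNorm_zero] at hθsup; exact hs.ne hθsup
  -- (2) the Euler side
  have hE : ∀ v ∈ S₀,
      (1 - C (embCoeff g ι (natGenerator v)) * X +
          (if natGenerator v ∣ M then 0 else C (natGenerator v : PadicAlgCl 2)) * X ^ 2).comp
        (C ((natGenerator v : PadicAlgCl 2)⁻¹) *
          (X + 1) ^ (PadicInt.toZModPow n (-(frobeniusExponent 2 (natGenerator v : ℤ_[2])))).val) ≠ 0 ∧
      layerLambda ((1 - C (embCoeff g ι (natGenerator v)) * X +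
          (if natGenerator v ∣ M then 0 else C (natGenerator v : PadicAlgCl 2)) * X ^ 2).comp
        (C ((natGenerator v : PadicAlgCl 2)⁻¹) *
          (X + 1) ^ (PadicInt.toZModPow n (-(frobeniusExponent 2 (natGenerator v : ℤ_[2])))).val)) =
        2 ^ t v * dg v := by
    intro v hv
    obtain ⟨h1, -, h3⟩ := layerEulerFactorK_two M v (embCoeff g ι (natGenerator v)) (hS' v hv)
      (norm_embCoeff_le_one hnew ι _) (htn v hv)
    exact ⟨h1, h3⟩
  obtain ⟨hEne, hElam⟩ := prod_ne_zero_and_layerLambda_prod S₀ _ fun v hv ↦ (hE v hv).1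
  have hElam' : layerLambda (∏ v ∈ S₀, (1 - C (embCoeff g ι (natGenerator v)) * X +
          (if natGenerator v ∣ M then 0 else C (natGenerator v : PadicAlgCl 2)) * X ^ 2).comp
        (C ((natGenerator v : PadicAlgCl 2)⁻¹) *
          (X + 1) ^ (PadicInt.toZModPow n (-(frobeniusExponent 2 (natGenerator v : ℤ_[2])))).val)) = SK := by
    rw [hElam, hSK]
    exact Finset.sum_congr rfl fun v hv ↦ (hE v hv).2
  -- (3) product and reduction modulo `ω_n`
  have hlam := (layerLambda_mul_modByMonic_layerModulus (p := 2) n hθne hEne (by rw [hθlam, hElam']; omega)).1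
  rw [hθlam, hElam'] at hlam
  rw [hlam]
  omega

end Stub

end Summit.BirchSwinnertonDyer.BirchSwinnertonDyer.Theorems.ResidualThetaLayer

end
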